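import Literature.AlgebraicGeometry.HodgeTheory.DegreeOneHodgeTypes
import Literature.AlgebraicGeometry.HodgeTheory.HodgeTypeVanishing
import Literature.AlgebraicGeometry.HodgeTheory.WeilClassesTestEigenspaces
import Literature.AlgebraicGeometry.Motives.AimedSplitProductProofs
import Literature.AlgebraicGeometry.HodgeTheory.CupPreservesHodgeTypeOfDeRham
import Literature.AlgebraicGeometry.HodgeTheory.HodgeFiltrationModelsReductionProofs
import Literature.NumberTheory.Transcendental.DeRhamTheoremMultiplicative
import HarnessLib

/-!
# The `K`-multiplicities of a Weil-type surface detected by test classes are `(1, 1)`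

Family `hodge`, layer `Literature/AlgebraicGeometry/HodgeTheory`. For an abelian SURFACE `B` with
`ψ ≫ ψ = -d` (`d > 0`), `V_± ⊆ H¹(B(ℂ); ℂ)` the eigenspaces of `ψ^*` for `±i√d` and
`S = (𝟙 + ψ)^*` on `H²(B(ℂ); ℂ)`, the "single-test" rendering of the Weil condition used by the fact
`Motives.exists_cmWeilSurface_aimedSplitProduct` provides classes `b₊ ∈ Eig(S, (1+i√d)²)`,
`b₋ ∈ Eig(S, (1-i√d)²)` with `b₊ + b₋` of Hodge type `(1,1)` and `b₊, b₋ ≠ 0`. We prove that this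
forces the `K = ℚ(√-d)`-multiplicities of `(B, ψ)` to be `(p, q) = (1, 1)`:

* `hodgeTypeSubmodule hX k p q` — the classes of Hodge type `(p, q)` in `Hᵏ(X(ℂ); ℂ)` as a
  submodule (general smooth projective `X`);
* `isOfHodgeType_two_zero_of_eigenvector` — if `H¹ = V_a ⊕ V_b` with `V_a ⊆ H^{1,0}`,
  `V_b ⊆ H^{0,1}`, then every eigenvector of `S` on `H²` for the eigenvalue `(1+a)²` (assumed
  different from `(1+a)(1+b)` and `(1+b)²`) is of type `(2,0)`: `H²` is spanned by products of
  degree-one classes (`H•(B) = Λ•H¹`, `surface_hasExteriorCohomologyH1`), the products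
  `V_a ⌣ V_a`, `V_a ⌣ V_b + V_b ⌣ V_a`, `V_b ⌣ V_b` have types `(2,0)`, `(1,1)`, `(0,2)` (cup product
  preserves types) and `S`-eigenvalues `(1+a)²`, `(1+a)(1+b)`, `(1+b)²` (`S` is multiplicative), and
  classes of different Hodge types are independent (`IsOfHodgeType.eq_zero_of_ne`);
* `finrank_eigenspace_inf_hodge_eq_one_of_testClasses` — **`dim (V₊ ∩ H^{1,0}) = 1` and
  `dim (V₊ ∩ H^{0,1}) = 1`**: `dim V₊ = 2 = p + q`; `p = 2` would put `V₊ ⊆ H^{1,0}`, `V₋ ⊆ H^{0,1}`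
  and make `b₊` of type `(2,0)` as well as `(1,1)`, so `b₊ = 0`; `p = 0` symmetrically kills `b₋`.

This is van Geemen's remark that a Weil-type surface `(B, K)` has `H^{1,0}(B) ≅ K ⊗_ℚ ℂ` as a
`K`-module (multiplicities `(1,1)`, LNM 1594, 5.6–5.8), in the cohomological rendering of the fact.
Everything is proved; the one `def` is a submodule; no named fact is introduced (D-0026).

## References

* [vanGeemen1994HodgeAV] B. van Geemen, An introduction to the Hodge conjecture for abelian
  varieties, LNM 1594 (1994), 4.9, 5.6–5.8, Lemma 6.7.
* [VoisinHodgeI2002] C. Voisin, Hodge Theory and Complex Algebraic Geometry I (CUP 2002), §6.1.3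
  Cor. 6.14, §7.1.2, §7.3.2.
* [LangeBirkenhake1992] H. Lange, Ch. Birkenhake, Complex Abelian Varieties (1992), §1.1 Lemma 1.1.17.
-/

noncomputable section

open CategoryTheory
open Literature.AlgebraicTopology.SingularHomology
open Literature.AlgebraicGeometry.Motives (IsSmoothProjective AbelianVariety)

namespace Literature.AlgebraicGeometry.HodgeTheory

section HodgeTheory

/-! ### Classes of a given Hodge type as a submodule -/

section Pieces

variable {n : ℕ} {X : Motives.SchemeOver ℂ}

/-- **The classes of Hodge type `(p, q)` in `Hᵏ(X(ℂ); ℂ)`** as a `ℂ`-submodule (`X` smooth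
projective; all Hodge models cut out the same `H^{p,q}`, so the set is closed under sums,
`IsOfHodgeType.add`). [cite: VoisinHodgeI2002, §6.1.3 and §7.1.1] -/
def hodgeTypeSubmodule (hX : IsSmoothProjective n X) (k p q : ℕ) : Submodule ℂ (complexBetti X k) where
  carrier := {c | IsOfHodgeType n X k p q c}
  add_mem' ha hb := ha.add hX hb
  zero_mem' := by
    obtain ⟨A⟩ := nonempty_hodgeModel_holds.nonempty hX
    exact ⟨A, by rw [map_zero]; exact Submodule.zero_mem _⟩
  smul_mem' c _ hx := hx.smul c

/-- Membership in `hodgeTypeSubmodule` is `IsOfHodgeType`. [folklore] -/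
@[simp]
theorem mem_hodgeTypeSubmodule (hX : IsSmoothProjective n X) {k p q : ℕ} {c : complexBetti X k} :
    c ∈ hodgeTypeSubmodule hX k p q ↔ IsOfHodgeType n X k p q c :=
  Iff.rfl

end Pieces

/-! ### Eigenvectors of `(𝟙 + ψ)^*` on `H²` of an abelian surface with pure eigenspaces on `H¹` -/

section Surface

variable {B : AbelianVariety ℂ} (hB : B.dim = 2) (ψ : B ⟶ B)

/-- `(𝟙 + ψ)^* (x ⌣ y) = (1+a)(1+a') (x ⌣ y)` for eigenvectors `x`, `y` of `ψ^*` on `H¹` with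
eigenvalues `a`, `a'` (multiplicativity and `(𝟙 + ψ)^* = 1 + ψ^*` on `H¹`). [cite: LangeBirkenhake1992, §1.1 Lemma 1.1.17] -/
theorem map_id_add_cupProduct_of_mem_eigenspace {a a' : ℂ} {x y : complexBetti B.X 1}
    (hx : x ∈ Module.End.eigenspace (complexBetti.map ψ.hom.hom.hom 1).hom a)
    (hy : y ∈ Module.End.eigenspace (complexBetti.map ψ.hom.hom.hom 1).hom a') :
    (complexBetti.map (𝟙 B + ψ).hom.hom.hom 2).hom (cupProduct one_add_one_eq_two x y) =
      ((1 + a) * (1 + a')) • cupProduct one_add_one_eq_two x y := by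
  have h1 : ∀ {c : ℂ} {v : complexBetti B.X 1},
      v ∈ Module.End.eigenspace (complexBetti.map ψ.hom.hom.hom 1).hom c →
        complexBetti.map (𝟙 B + ψ).hom.hom.hom 1 v = (1 + c) • v := by
    intro c v hv
    rw [complexBetti_map_add_deg_one, add_smul, one_smul]
    change complexBetti.map (𝟙 B.X) 1 v + (complexBetti.map ψ.hom.hom.hom 1).hom v = _
    rw [complexBetti.map_id, Module.End.mem_eigenspace_iff.1 hv]
    rfl
  change complexBetti.map (𝟙 B + ψ).hom.hom.hom 2 (cupProduct _ x y) = _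
  rw [cupProduct_map, h1 hx, h1 hy, LinearMap.map_smul₂, LinearMap.map_smul, smul_smul, mul_comm]

include hB

/-- **Eigenvectors of `S = (𝟙 + ψ)^*` on `H²(B)` for `(1+a)²` are of type `(2,0)` when
`H¹ = V_a ⊕ V_b`, `V_a ⊆ H^{1,0}`, `V_b ⊆ H^{0,1}`** and `(1+a)² ∉ {(1+a)(1+b), (1+b)²}`: `H²(B)` is
spanned by products of degree-one classes; the pieces `V_a ⌣ V_a ⊆ H^{2,0} ∩ Eig(S,(1+a)²)`,
`V_a ⌣ V_b + V_b ⌣ V_a ⊆ H^{1,1} ∩ Eig(S,(1+a)(1+b))`, `V_b ⌣ V_b ⊆ H^{0,2} ∩ Eig(S,(1+b)²)` exhaust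
`H²`, and applying `S - (1+a)²` to a decomposition of the eigenvector leaves a `(1,1)`-class equal
to a `(0,2)`-class, i.e. zero. [cite: vanGeemen1994HodgeAV, Lemma 6.7 and 6.11]
[cite: VoisinHodgeI2002, Cor. 6.14 and §7.3.2] -/
theorem isOfHodgeType_two_zero_of_eigenvector {a b : ℂ}
    (hsup : Module.End.eigenspace (complexBetti.map ψ.hom.hom.hom 1).hom a ⊔
      Module.End.eigenspace (complexBetti.map ψ.hom.hom.hom 1).hom b = ⊤)
    (ha : Module.End.eigenspace (complexBetti.map ψ.hom.hom.hom 1).hom a ≤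
      hodgeOneZero (Motives.isSmoothProjective_of_dim_eq' hB))
    (hb : Module.End.eigenspace (complexBetti.map ψ.hom.hom.hom 1).hom b ≤
      hodgeZeroOne (Motives.isSmoothProjective_of_dim_eq' hB))
    (h₁ : (1 + a) ^ 2 ≠ (1 + a) * (1 + b)) (h₂ : (1 + a) ^ 2 ≠ (1 + b) ^ 2)
    {v : complexBetti B.X 2}
    (hv : v ∈ Module.End.eigenspace (complexBetti.map (𝟙 B + ψ).hom.hom.hom 2).hom ((1 + a) ^ 2)) :
    IsOfHodgeType 2 B.X 2 2 0 v := by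
  have hBs : IsSmoothProjective 2 B.X := Motives.isSmoothProjective_of_dim_eq' hB
  set S := (complexBetti.map (𝟙 B + ψ).hom.hom.hom 2).hom with hS
  set Ea := Module.End.eigenspace (complexBetti.map ψ.hom.hom.hom 1).hom a with hEa
  set Eb := Module.End.eigenspace (complexBetti.map ψ.hom.hom.hom 1).hom b with hEb
  have hcup : CupPreservesHodgeType 2 B.X :=
    cupPreservesHodgeType_of_nonempty_hodgeModel hodgePQ_independent_of_hodgeModel_holds
      nonempty_hodgeModel_holds
      (fun F _ _ _ ↦ Literature.NumberTheory.Transcendental.exists_deRhamIsoFamily_holds F) hBs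
  -- the three pieces of `H²`
  set M₁ := hodgeTypeSubmodule hBs 2 2 0 ⊓ Module.End.eigenspace S ((1 + a) ^ 2) with hM₁
  set M₂ := hodgeTypeSubmodule hBs 2 1 1 ⊓ Module.End.eigenspace S ((1 + a) * (1 + b)) with hM₂
  set M₃ := hodgeTypeSubmodule hBs 2 0 2 ⊓ Module.End.eigenspace S ((1 + b) ^ 2) with hM₃
  -- every product of degree-one classes lies in `M₁ ⊔ M₂ ⊔ M₃`
  have hprod : ∀ x y : complexBetti B.X 1, cupProduct one_add_one_eq_two x y ∈ M₁ ⊔ M₂ ⊔ M₃ := by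
    intro x y
    have hx : x ∈ Ea ⊔ Eb := by rw [hsup]; exact Submodule.mem_top
    have hy : y ∈ Ea ⊔ Eb := by rw [hsup]; exact Submodule.mem_top
    obtain ⟨x₁, hx₁, x₂, hx₂, rfl⟩ := Submodule.mem_sup.1 hx
    obtain ⟨y₁, hy₁, y₂, hy₂, rfl⟩ := Submodule.mem_sup.1 hy
    rw [LinearMap.map_add₂, map_add, map_add]
    have hx₁t : IsOfHodgeType 2 B.X 1 1 0 x₁ := ha hx₁
    have hy₁t : IsOfHodgeType 2 B.X 1 1 0 y₁ := ha hy₁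
    have hx₂t : IsOfHodgeType 2 B.X 1 0 1 x₂ := hb hx₂
    have hy₂t : IsOfHodgeType 2 B.X 1 0 1 y₂ := hb hy₂
    -- Hodge types of the four products
    have t₁ : IsOfHodgeType 2 B.X 2 2 0 (cupProduct one_add_one_eq_two x₁ y₁) := by
      simpa using hcup one_add_one_eq_two hx₁t hy₁t
    have t₂ : IsOfHodgeType 2 B.X 2 1 1 (cupProduct one_add_one_eq_two x₁ y₂) := by
      simpa using hcup one_add_one_eq_two hx₁t hy₂t
    have t₃ : IsOfHodgeType 2 B.X 2 1 1 (cupProduct one_add_one_eq_two x₂ y₁) := by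
      simpa using hcup one_add_one_eq_two hx₂t hy₁t
    have t₄ : IsOfHodgeType 2 B.X 2 0 2 (cupProduct one_add_one_eq_two x₂ y₂) := by
      simpa using hcup one_add_one_eq_two hx₂t hy₂t
    -- eigenvalues of the four products
    have e₁ : cupProduct one_add_one_eq_two x₁ y₁ ∈ Module.End.eigenspace S ((1 + a) ^ 2) := by
      rw [Module.End.mem_eigenspace_iff, map_id_add_cupProduct_of_mem_eigenspace ψ hx₁ hy₁, sq]
    have e₂ : cupProduct one_add_one_eq_two x₁ y₂ ∈ Module.End.eigenspace S ((1 + a) * (1 + b)) := by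
      rw [Module.End.mem_eigenspace_iff, map_id_add_cupProduct_of_mem_eigenspace ψ hx₁ hy₂]
    have e₃ : cupProduct one_add_one_eq_two x₂ y₁ ∈ Module.End.eigenspace S ((1 + a) * (1 + b)) := by
      rw [Module.End.mem_eigenspace_iff, map_id_add_cupProduct_of_mem_eigenspace ψ hx₂ hy₁, mul_comm]
    have e₄ : cupProduct one_add_one_eq_two x₂ y₂ ∈ Module.End.eigenspace S ((1 + b) ^ 2) := by
      rw [Module.End.mem_eigenspace_iff, map_id_add_cupProduct_of_mem_eigenspace ψ hx₂ hy₂, sq]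
    have m₁ : cupProduct one_add_one_eq_two x₁ y₁ ∈ M₁ := Submodule.mem_inf.2 ⟨t₁, e₁⟩
    have m₂ : cupProduct one_add_one_eq_two x₁ y₂ ∈ M₂ := Submodule.mem_inf.2 ⟨t₂, e₂⟩
    have m₃ : cupProduct one_add_one_eq_two x₂ y₁ ∈ M₂ := Submodule.mem_inf.2 ⟨t₃, e₃⟩
    have m₄ : cupProduct one_add_one_eq_two x₂ y₂ ∈ M₃ := Submodule.mem_inf.2 ⟨t₄, e₄⟩
    exact Submodule.add_mem _
      (Submodule.add_mem _ (Submodule.mem_sup_left (Submodule.mem_sup_left m₁))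
        (Submodule.mem_sup_left (Submodule.mem_sup_right m₂)))
      (Submodule.add_mem _ (Submodule.mem_sup_left (Submodule.mem_sup_right m₃))
        (Submodule.mem_sup_right m₄))
  -- hence `H² = M₁ ⊔ M₂ ⊔ M₃`
  have htop : (⊤ : Submodule ℂ (complexBetti B.X 2)) ≤ M₁ ⊔ M₂ ⊔ M₃ := by
    rw [← (surface_hasExteriorCohomologyH1 B).span_range_cupPowOne 2, Submodule.span_le]
    rintro _ ⟨u, rfl⟩
    rw [SetLike.mem_coe, cupPowOne_succ, Fin.tail_def]
    simp only [cupPowOne_one]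
    exact hprod (u 0) (u 1)
  -- decompose `v` and apply `S - (1+a)²`
  obtain ⟨m, hm, m₃, ⟨hm₃t, hm₃e⟩, hv'⟩ := Submodule.mem_sup.1 (htop (Submodule.mem_top (x := v)))
  obtain ⟨m₁, ⟨hm₁t, hm₁e⟩, m₂, ⟨hm₂t, hm₂e⟩, rfl⟩ := Submodule.mem_sup.1 hm
  rw [SetLike.mem_coe, Module.End.mem_eigenspace_iff] at hm₁e hm₂e hm₃e
  have hve := Module.End.mem_eigenspace_iff.1 hv
  rw [← hv', map_add, map_add, hm₁e, hm₂e, hm₃e, smul_add, smul_add] at hve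
  -- `(λ₂ - λ₁) m₂ + (λ₃ - λ₁) m₃ = 0`
  have hrel : ((1 + a) * (1 + b) - (1 + a) ^ 2) • m₂ + ((1 + b) ^ 2 - (1 + a) ^ 2) • m₃ = 0 := by
    rw [sub_smul, sub_smul]
    have h := hve
    -- `λ₁ m₁ + λ₂ m₂ + λ₃ m₃ = λ₁ m₁ + λ₁ m₂ + λ₁ m₃`
    calc ((1 + a) * (1 + b)) • m₂ - (1 + a) ^ 2 • m₂ + ((1 + b) ^ 2 • m₃ - (1 + a) ^ 2 • m₃)
        = ((1 + a) ^ 2 • m₁ + ((1 + a) * (1 + b)) • m₂ + (1 + b) ^ 2 • m₃) -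
            ((1 + a) ^ 2 • m₁ + (1 + a) ^ 2 • m₂ + (1 + a) ^ 2 • m₃) := by abel
      _ = 0 := by rw [h, sub_self]
  have h2t : IsOfHodgeType 2 B.X 2 1 1 (((1 + a) * (1 + b) - (1 + a) ^ 2) • m₂) := hm₂t.smul _
  have h3t : IsOfHodgeType 2 B.X 2 0 2 (((1 + b) ^ 2 - (1 + a) ^ 2) • m₃) := hm₃t.smul _
  have h2t' : IsOfHodgeType 2 B.X 2 0 2 (((1 + a) * (1 + b) - (1 + a) ^ 2) • m₂) := by
    rw [eq_neg_of_add_eq_zero_left hrel]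
    exact h3t.neg
  have hm₂0 : ((1 + a) * (1 + b) - (1 + a) ^ 2) • m₂ = 0 :=
    IsOfHodgeType.eq_zero_of_ne hBs h2t h2t' (by simp)
  have hm₂z : m₂ = 0 := by
    rcases smul_eq_zero.1 hm₂0 with h | h
    · exact absurd (sub_eq_zero.1 h).symm h₁
    · exact h
  rw [hm₂0, zero_add] at hrel
  have hm₃z : m₃ = 0 := by
    rcases smul_eq_zero.1 hrel with h | h
    · exact absurd (sub_eq_zero.1 h).symm h₂
    · exact h
  rw [← hv', hm₂z, hm₃z, add_zero, add_zero]
  exact hm₁t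

/-- `(S - λ')(b + b') = (λ - λ') b` isolates an eigencomponent: if `b ∈ Eig(S, λ)`, `b' ∈ Eig(S, λ')`,
`λ ≠ λ'` and `b + b'` is of Hodge type `(1,1)`, then `b` is of type `(1,1)` (`S = (𝟙 + ψ)^*`
preserves types). [cite: VoisinHodgeI2002, §7.3.2] -/
theorem isOfHodgeType_one_one_of_add {l l' : ℂ} (hl : l ≠ l') {c c' : complexBetti B.X 2}
    (hc : c ∈ Module.End.eigenspace (complexBetti.map (𝟙 B + ψ).hom.hom.hom 2).hom l)
    (hc' : c' ∈ Module.End.eigenspace (complexBetti.map (𝟙 B + ψ).hom.hom.hom 2).hom l')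
    (h11 : IsOfHodgeType 2 B.X 2 1 1 (c + c')) : IsOfHodgeType 2 B.X 2 1 1 c := by
  have hBs : IsSmoothProjective 2 B.X := Motives.isSmoothProjective_of_dim_eq' hB
  set S := (complexBetti.map (𝟙 B + ψ).hom.hom.hom 2).hom with hS
  rw [Module.End.mem_eigenspace_iff] at hc hc'
  have hS11 : IsOfHodgeType 2 B.X 2 1 1 (S (c + c')) := h11.map_of_isSmoothProjective hBs hBs _
  have hdiff : S (c + c') - l' • (c + c') = (l - l') • c := by
    rw [map_add, hc, hc', smul_add, sub_smul]; abel
  have ht : IsOfHodgeType 2 B.X 2 1 1 ((l - l') • c) := by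
    rw [← hdiff]; exact hS11.sub hBs (h11.smul _)
  have hl0 : l - l' ≠ 0 := sub_ne_zero.2 hl
  have e : c = (l - l')⁻¹ • ((l - l') • c) := by rw [smul_smul, inv_mul_cancel₀ hl0, one_smul]
  rw [e]
  exact ht.smul _

omit hB in
/-- Arithmetic of `μ = i√d`, `d > 0`: `(1+μ)² ≠ (1+μ)(1-μ)`, `(1+μ)² ≠ (1-μ)²`, `(1-μ)² ≠ (1-μ)(1+μ)`.
[folklore] -/
theorem testEigenvalues_ne {d : ℕ} (hd : 0 < d) :
    (1 + Complex.I * (Real.sqrt d : ℂ)) ^ 2 ≠ (1 + Complex.I * (Real.sqrt d : ℂ)) * (1 - Complex.I * (Real.sqrt d : ℂ)) ∧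
    (1 + Complex.I * (Real.sqrt d : ℂ)) ^ 2 ≠ (1 - Complex.I * (Real.sqrt d : ℂ)) ^ 2 ∧
    (1 - Complex.I * (Real.sqrt d : ℂ)) ^ 2 ≠ (1 - Complex.I * (Real.sqrt d : ℂ)) * (1 + Complex.I * (Real.sqrt d : ℂ)) := by
  set s : ℂ := Complex.I * (Real.sqrt d : ℂ) with hs
  have hsq : (Real.sqrt d : ℂ) * (Real.sqrt d : ℂ) = d := by
    rw [← Complex.ofReal_mul, Real.mul_self_sqrt (Nat.cast_nonneg d), Complex.ofReal_natCast]
  have hs0 : (Real.sqrt d : ℂ) ≠ 0 := by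
    rw [Ne, Complex.ofReal_eq_zero, Real.sqrt_eq_zero (Nat.cast_nonneg d)]
    exact_mod_cast hd.ne'
  have hμ0 : s ≠ 0 := mul_ne_zero Complex.I_ne_zero hs0
  have hμ2 : s * s = -(d : ℂ) := by rw [hs, mul_mul_mul_comm, Complex.I_mul_I, hsq, neg_one_mul]
  have h1p : (1 + s) ≠ 0 := by
    intro h
    have h' := congrArg Complex.re h
    simp [hs] at h'
  have h1m : (1 - s) ≠ 0 := by
    intro h
    have h' := congrArg Complex.re h
    simp [hs] at h'
  refine ⟨fun h ↦ ?_, fun h ↦ ?_, fun h ↦ ?_⟩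
  · have h' : (1 + s) * ((1 + s) - (1 - s)) = 0 := by rw [mul_sub, ← sq, h, sub_self]
    rcases mul_eq_zero.1 h' with h'' | h''
    · exact h1p h''
    · apply hμ0; linear_combination h'' / 2
  · have h' : 4 * s = 0 := by linear_combination h
    exact hμ0 (by simpa using h')
  · have h' : (1 - s) * ((1 - s) - (1 + s)) = 0 := by rw [mul_sub, ← sq, h, sub_self]
    rcases mul_eq_zero.1 h' with h'' | h''
    · exact h1m h''
    · apply hμ0; linear_combination -h'' / 2

/-- **The multiplicities of a test-detected Weil surface are `(1, 1)`.** Let `B` be an abelian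
surface, `ψ ≫ ψ = -d` (`d > 0`), `μ = i√d`, `V₊ = Eig(ψ^*|H¹, μ)`, `S = (𝟙 + ψ)^*` on `H²(B(ℂ); ℂ)`,
and let `b₊ ∈ Eig(S, (1+μ)²)`, `b₋ ∈ Eig(S, (1-μ)²)` be NON-ZERO with `b₊ + b₋` of Hodge type
`(1,1)`. Then `dim (V₊ ∩ H^{1,0}) = 1 = dim (V₊ ∩ H^{0,1})`: `dim V₊ = 2 = p + q`
(`two_mul_finrank_eigenspace_eq`, `finrank_eigenspace_eq_add`); if `p = 2` then `V₊ ⊆ H^{1,0}`,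
`V₋ = V̄₊ ⊆ H^{0,1}` and `b₊` is of type `(2,0)` (`isOfHodgeType_two_zero_of_eigenvector`) and
`(1,1)`, hence `0`; if `p = 0`, symmetrically `b₋ = 0`. (A Weil-type surface has `K`-multiplicities
`(1,1)`: van Geemen 5.6–5.8.) [cite: vanGeemen1994HodgeAV, 4.9 and 5.6–5.8]
[cite: VoisinHodgeI2002, Cor. 6.14] -/
theorem finrank_eigenspace_inf_hodge_eq_one_of_testClasses {d : ℕ} (hd : 0 < d)
    (hψ : ψ ≫ ψ = -(d • 𝟙 B)) {bp bm : complexBetti B.X 2}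
    (hbp : bp ∈ Module.End.eigenspace (complexBetti.map (𝟙 B + ψ).hom.hom.hom 2).hom
      ((1 + Complex.I * (Real.sqrt d : ℂ)) ^ 2))
    (hbm : bm ∈ Module.End.eigenspace (complexBetti.map (𝟙 B + ψ).hom.hom.hom 2).hom
      ((1 - Complex.I * (Real.sqrt d : ℂ)) ^ 2))
    (h11 : IsOfHodgeType 2 B.X 2 1 1 (bp + bm)) (hbp0 : bp ≠ 0) (hbm0 : bm ≠ 0) :
    Module.finrank ℂ ↥(Module.End.eigenspace (complexBetti.map ψ.hom.hom.hom 1).hom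
        (Complex.I * (Real.sqrt d : ℂ)) ⊓ hodgeOneZero (Motives.isSmoothProjective_of_dim_eq' hB)) = 1 ∧
      Module.finrank ℂ ↥(Module.End.eigenspace (complexBetti.map ψ.hom.hom.hom 1).hom
        (Complex.I * (Real.sqrt d : ℂ)) ⊓ hodgeZeroOne (Motives.isSmoothProjective_of_dim_eq' hB)) = 1 := by
  have hBs : IsSmoothProjective 2 B.X := Motives.isSmoothProjective_of_dim_eq' hB
  haveI := finite_complexBetti_abelianVariety B 1
  set μ : ℂ := Complex.I * (Real.sqrt d : ℂ) with hμ
  set T := (complexBetti.map ψ.hom.hom.hom 1).hom with hT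
  set Ep := Module.End.eigenspace T μ with hEp
  set Em := Module.End.eigenspace T (-μ) with hEm
  obtain ⟨hne₁, hne₂, hne₃⟩ := testEigenvalues_ne hd
  -- `b₊`, `b₋` are of type `(1,1)`
  have hbp11 : IsOfHodgeType 2 B.X 2 1 1 bp := isOfHodgeType_one_one_of_add hB ψ hne₂ hbp hbm h11
  have hbm11 : IsOfHodgeType 2 B.X 2 1 1 bm :=
    isOfHodgeType_one_one_of_add hB ψ (Ne.symm hne₂) hbm hbp (by rwa [add_comm])
  -- dimensions: `dim V₊ = dim V₋ = 2 = p + q`, `(p₋, q₋) = (q, p)`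
  have h4 : Module.finrank ℂ (complexBetti B.X 1) = 4 := by rw [surface_finrank_complexBetti_one, hB]
  have hEp2 : Module.finrank ℂ Ep = 2 := by
    have h := two_mul_finrank_eigenspace_eq hd hψ
    rw [h4] at h
    change 2 * Module.finrank ℂ Ep = 4 at h
    omega
  have hEm2 : Module.finrank ℂ Em = 2 := by
    rw [hEm, ← finrank_eigenspace_eq_finrank_eigenspace_neg hd hψ]; exact hEp2
  have hsum := finrank_eigenspace_eq_add hBs ψ.hom.hom.hom μ
  have hsum' := finrank_eigenspace_eq_add hBs ψ.hom.hom.hom (-μ)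
  have hconj : (starRingEnd ℂ) μ = -μ := by
    rw [hμ, map_mul, Complex.conj_I, Complex.conj_ofReal, neg_mul]
  have hconj' : (starRingEnd ℂ) (-μ) = μ := by rw [map_neg, hconj, neg_neg]
  have hqm : Module.finrank ℂ ↥(Em ⊓ hodgeZeroOne hBs) = Module.finrank ℂ ↥(Ep ⊓ hodgeOneZero hBs) := by
    rw [hEm, ← hconj]; exact finrank_eigenspace_inf_hodgeZeroOne_eq hBs ψ.hom.hom.hom μ
  have hpm : Module.finrank ℂ ↥(Em ⊓ hodgeOneZero hBs) = Module.finrank ℂ ↥(Ep ⊓ hodgeZeroOne hBs) := by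
    rw [← finrank_eigenspace_inf_hodgeZeroOne_eq hBs ψ.hom.hom.hom (-μ), hconj']
  change Module.finrank ℂ Ep = Module.finrank ℂ ↥(Ep ⊓ hodgeOneZero hBs) +
    Module.finrank ℂ ↥(Ep ⊓ hodgeZeroOne hBs) at hsum
  change Module.finrank ℂ Em = Module.finrank ℂ ↥(Em ⊓ hodgeOneZero hBs) +
    Module.finrank ℂ ↥(Em ⊓ hodgeZeroOne hBs) at hsum'
  rw [hEp2] at hsum
  rw [hEm2] at hsum'
  have hsup : Ep ⊔ Em = ⊤ := eigenspace_sup_eigenspace_neg_eq_top hd hψ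
  -- a subspace of full dimension is everything
  have hfull : ∀ {E : Submodule ℂ (complexBetti B.X 1)} {P : Submodule ℂ (complexBetti B.X 1)},
      Module.finrank ℂ ↥(E ⊓ P) = Module.finrank ℂ E → E ≤ P := by
    intro E P h
    have heq : E ⊓ P = E := Submodule.eq_of_le_of_finrank_eq inf_le_left h
    exact (inf_eq_left.1 heq)
  -- case analysis on `p`
  set p := Module.finrank ℂ ↥(Ep ⊓ hodgeOneZero hBs) with hp
  set q := Module.finrank ℂ ↥(Ep ⊓ hodgeZeroOne hBs) with hq
  change Module.finrank ℂ ↥(Em ⊓ hodgeZeroOne hBs) = p at hqm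
  change Module.finrank ℂ ↥(Em ⊓ hodgeOneZero hBs) = q at hpm
  by_cases hp2 : p = 2
  · -- `V₊ ⊆ H^{1,0}`, `V₋ ⊆ H^{0,1}`: `b₊` would be of type `(2,0)`
    exfalso
    have hle₁ : Ep ≤ hodgeOneZero hBs := hfull (by rw [← hp, hp2, hEp2])
    have hle₂ : Em ≤ hodgeZeroOne hBs := hfull (by rw [hqm, hp2, hEm2])
    have h20 : IsOfHodgeType 2 B.X 2 2 0 bp :=
      isOfHodgeType_two_zero_of_eigenvector hB ψ hsup hle₁ hle₂ (by rwa [← sub_eq_add_neg])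
        (by rwa [← sub_eq_add_neg]) hbp
    exact hbp0 (IsOfHodgeType.eq_zero_of_ne hBs h20 hbp11 (by simp))
  by_cases hp0 : p = 0
  · -- `V₊ ⊆ H^{0,1}`, `V₋ ⊆ H^{1,0}`: `b₋` would be of type `(2,0)`
    exfalso
    have hq2 : q = 2 := by omega
    have hle₁ : Em ≤ hodgeOneZero hBs := hfull (by rw [hpm, hq2, hEm2])
    have hle₂ : Ep ≤ hodgeZeroOne hBs := hfull (by rw [← hq, hq2, hEp2])
    have hsup' : Em ⊔ Ep = ⊤ := by rw [sup_comm]; exact hsup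
    have hbm' : bm ∈ Module.End.eigenspace (complexBetti.map (𝟙 B + ψ).hom.hom.hom 2).hom
        ((1 + -μ) ^ 2) := by rwa [← sub_eq_add_neg]
    have h20 : IsOfHodgeType 2 B.X 2 2 0 bm :=
      isOfHodgeType_two_zero_of_eigenvector hB ψ hsup' hle₁ hle₂
        (by rw [← sub_eq_add_neg]; exact hne₃)
        (by rw [← sub_eq_add_neg]; exact Ne.symm hne₂) hbm'
    exact hbm0 (IsOfHodgeType.eq_zero_of_ne hBs h20 hbm11 (by simp))
  constructor <;> omega

end Surface

end HodgeTheory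

end Literature.AlgebraicGeometry.HodgeTheory

end
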